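import Summits.ResolutionOfSingularities.ResolutionOfSingularities.Theorems.DescentDescentPerfectToAllLevelResolution
import Summits.ResolutionOfSingularities.ResolutionOfSingularities.Theorems.DescentDescentPerfectToAllFgModel
import Summits.ResolutionOfSingularities.ResolutionOfSingularities.Theorems.DescentDescentPerfectToAllRobustModel
import Summits.ResolutionOfSingularities.ResolutionOfSingularities.Theorems.WeightedInvariantDescentReducedToIntegral
import Literature.AlgebraicGeometry.Resolution.SmoothOfRegularPerfectField
import Literature.AlgebraicGeometry.Resolution.SmoothStalksRegular
import Literature.AlgebraicGeometry.Resolution.AlterationsDescentStage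
import Literature.AlgebraicGeometry.Limits.FiniteTypeModelDescent
import Mathlib.FieldTheory.PurelyInseparable.PerfectClosure
import Mathlib.FieldTheory.IsPerfectClosure
import Mathlib.Algebra.CharP.IntermediateField
import HarnessLib

/-!
# Crux `PrimeFieldToPerfect` (stmt-ResolutionOfSingularities-15233), line `birth`: stub `stub_limitDescent`

Route `ResolutionOfSingularities/UniversalCells`, crux `PrimeFieldToPerfect`
(stmt-ResolutionOfSingularities-15233), stub `stub_limitDescent` of the lead's skeleton, PROVED here
(statement verbatim from the ledger registration).

**Statement (limit descent from a perfect purely inseparable extension).** Fix a prime `p` and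
assume the *smooth twist* property `h`: for every finitely generated field `K₁` of characteristic
`p` and every separated `K₁`-scheme of finite type `X₁` which becomes integral over some perfect
purely inseparable extension of `K₁`, there are a FINITE purely inseparable `K'/K₁` and a proper
birational `π : Y → X₁ ×_{K₁} K'` with `Y` smooth over `K'`. Let `K` be a finitely generated field
of characteristic `p`, `L ⊇ K` perfect and purely inseparable over `K` (so `L ≅ K^{perf}`), and
`f : X → Spec L` separated of finite type with `X` integral. Then `X` admits a resolution of
singularities.

**Proof.**
1. *Descent to a finitely generated level* (EGA IV₃ 8.8.2 (ii), tree lemma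
   `Literature.AlgebraicGeometry.Limits.exists_isPullback_specMap_subalgebra`): `X ≅ X' ×_R Spec L`
   for a finitely generated `K`-subalgebra `R = K[t] ⊆ L` and a separated finite type
   `X' → Spec R`; with `K₁ = K(t) ⊇ R` (an intermediate field of `L/K`, finitely generated as a
   field, purely inseparable under `L`) and `X₁ = X' ×_R Spec K₁` we get `X ≅ X₁ ×_{K₁} Spec L`.
2. `X → X₁` is flat and surjective (base change of `Spec L → Spec K₁`), so `X₁` is integral
   (`DeJong1996.Stage.isIntegral_of_flat_surjective`); apply `h` to `(K₁, X₁)` with witness `L`.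
3. The finite purely inseparable `K'/K₁` embeds into the perfect field `L` over `K₁`
   (`PerfectRing.lift`: `p`-radical maps lift uniquely into perfect rings).
4. Base change `π` along `Spec L → Spec K'`: the result `Y ×_{K'} L → X₁ ×_{K₁} L ≅ X` is proper and
   birational (flat base change between Noetherian schemes,
   `Theorems.hasResolution_pullback_snd_of_flat`) and its source is smooth over the field `L`, hence
   regular (Stacks 056S, `isRegularLocalRing_stalk_of_smooth_of_field`).

## References

* A. Grothendieck, J. Dieudonné, EGA IV₃, Publ. Math. IHÉS 28 (1966), Thm. 8.8.2 (ii). [EGAIV3]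
* The Stacks Project, Tag 056S.
-/

noncomputable section

set_option linter.dupNamespace false -- mandated namespace of this single-conjunct summit

open CategoryTheory CategoryTheory.Limits AlgebraicGeometry TopologicalSpace
open Literature.AlgebraicGeometry.Resolution

namespace Summit.ResolutionOfSingularities.ResolutionOfSingularities.Theorems.PrimeFieldToPerfect

universe u

/-- **Limit descent** (stub `stub_limitDescent`): if finitely generated fields of characteristic
`p` have the *smooth twist* property `h` (every separated finite type `X₀/K` that becomes integral
over a perfect purely inseparable extension acquires, after a FINITE purely inseparable extension
`K'/K`, a proper birational `Y → X₀ ×_K K'` with `Y` smooth over `K'`), then every integral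
separated scheme of finite type over a perfect purely inseparable extension `L` of a finitely
generated field `K` of characteristic `p` admits a resolution of singularities: descend `X/L` to a
finitely generated level `K₁ ⊆ L` (EGA IV₃ 8.8.2 (ii)), apply `h`, embed `K'` into the perfect `L`
(`PerfectRing.lift`) and base-change the smooth model to `L` (smooth over a field is regular,
Stacks 056S; birationality survives flat base change). [cite: EGAIV3, Thm. 8.8.2 (ii)] -/
theorem stub_limitDescent (p : ℕ) (hp : p.Prime) (h : ∀ (K : Type) [Field K] [CharP K p], (∃ s : Finset K, Subfield.closure (s : Set K) = ⊤) → ∀ (X₀ : Scheme.{0}) (f₀ : X₀ ⟶ Spec (.of K)), IsSeparated f₀ → LocallyOfFiniteType f₀ → QuasiCompact f₀ → (∃ (L : Type) (_ : Field L) (_ : PerfectField L) (_ : Algebra K L) (_ : IsPurelyInseparable K L), IsIntegral (pullback f₀ (Spec.map (CommRingCat.ofHom (algebraMap K L))))) → ∃ (K' : Type) (_ : Field K') (_ : Algebra K K') (_ : IsPurelyInseparable K K') (_ : Module.Finite K K') (Y : Scheme.{0}) (π : Y ⟶ pullback f₀ (Spec.map (CommRingCat.ofHom (algebraMap K K')))),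 IsProper π ∧ IsBirational π ∧ Smooth (π ≫ pullback.snd f₀ (Spec.map (CommRingCat.ofHom (algebraMap K K'))))) (K : Type) [Field K] [CharP K p] (hK : ∃ s : Finset K, Subfield.closure (s : Set K) = ⊤) (L : Type) [Field L] [PerfectField L] [Algebra K L] [IsPurelyInseparable K L] (X : Scheme.{0}) (f : X ⟶ Spec (.of L)) (hs : IsSeparated f) (hl : LocallyOfFiniteType f) (hq : QuasiCompact f) (hX : IsIntegral X) : Scheme.HasResolution X := by
  classical
  haveI : Fact p.Prime := ⟨hp⟩
  haveI : ExpChar K p := ExpChar.prime hp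
  haveI : CharP L p := charP_of_injective_algebraMap (algebraMap K L).injective p
  haveI : ExpChar L p := ExpChar.prime hp
  -- ### Step 1: descent of `X / L` to a finitely generated `K`-subalgebra `R ⊆ L`
  obtain ⟨R, X', p', π, hRfg, hsep', hlft', hqc', hsq⟩ :=
    Literature.AlgebraicGeometry.Limits.exists_isPullback_specMap_subalgebra (K := K) f
  haveI := hsep'
  haveI := hlft'
  haveI := hqc'
  obtain ⟨t, ht⟩ := hRfg
  -- the finitely generated level `K₁ = K(t) ⊇ R = K[t]`, an intermediate field of `L / K`
  obtain ⟨K₁, hK₁⟩ : ∃ K₁ : IntermediateField K L, K₁ = IntermediateField.adjoin K (↑t : Set L) :=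
    ⟨_, rfl⟩
  have hRK₁ : ∀ x : L, x ∈ R → x ∈ K₁ := fun x hx => by
    rw [hK₁]
    rw [← ht] at hx
    exact IntermediateField.algebra_adjoin_le_adjoin K _ hx
  -- `K₁` is finitely generated as a field: by the images of the generators of `K` and by `t`
  have hFG₁ : ∃ s₁ : Finset K₁, Subfield.closure (s₁ : Set K₁) = ⊤ := by
    obtain ⟨sK, hsK⟩ := hK
    have hsub : ∀ x ∈ sK.image (algebraMap K L) ∪ t, x ∈ K₁ := by
      intro x hx
      rcases Finset.mem_union.1 hx with hx | hx
      · obtain ⟨y, -, rfl⟩ := Finset.mem_image.1 hx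
        exact K₁.algebraMap_mem y
      · rw [hK₁]
        exact IntermediateField.subset_adjoin K _ (Finset.mem_coe.2 hx)
    refine ⟨(sK.image (algebraMap K L) ∪ t).subtype (· ∈ K₁), ?_⟩
    have hinj : Function.Injective (Subfield.map (algebraMap K₁ L)) := fun A B hAB => by
      rw [← Subfield.comap_map (algebraMap K₁ L) A, hAB, Subfield.comap_map]
    apply hinj
    have h1 : (algebraMap K₁ L) '' (↑((sK.image (algebraMap K L) ∪ t).subtype (· ∈ K₁)) :
        Set K₁) = ↑(sK.image (algebraMap K L) ∪ t) := by
      ext x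
      refine ⟨?_, fun hx => ⟨⟨x, hsub x (Finset.mem_coe.1 hx)⟩,
        Finset.mem_coe.2 (Finset.mem_subtype.2 (Finset.mem_coe.1 hx)), rfl⟩⟩
      rintro ⟨y, hy, rfl⟩
      exact Finset.mem_coe.2 (Finset.mem_subtype.1 (Finset.mem_coe.1 hy))
    have h2 : (algebraMap K₁ L).fieldRange = K₁.toSubfield := by
      ext x
      rw [RingHom.mem_fieldRange, IntermediateField.mem_toSubfield]
      exact ⟨fun ⟨y, hy⟩ => hy ▸ y.2, fun hx => ⟨⟨x, hx⟩, rfl⟩⟩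
    rw [RingHom.map_field_closure, ← RingHom.fieldRange_eq_map, h1, h2, hK₁,
      IntermediateField.adjoin_toSubfield, Finset.coe_union, Finset.coe_image,
      Subfield.closure_union, Subfield.closure_union, ← RingHom.map_field_closure, hsK,
      ← RingHom.fieldRange_eq_map, ← RingHom.coe_fieldRange, Subfield.closure_eq]
  -- the inclusion `R ⊆ K₁` and the factorisation `Spec L → Spec K₁ → Spec R` of `Spec (R ⊆ L)`
  let ι : R →+* K₁ := R.val.toRingHom.codRestrict K₁ fun x => hRK₁ x.1 x.2
  have hι : (algebraMap K₁ L).comp ι = R.val.toRingHom := RingHom.ext fun _ => rfl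
  have hfac : Spec.map (CommRingCat.ofHom (algebraMap K₁ L)) ≫ Spec.map (CommRingCat.ofHom ι) =
      Spec.map (CommRingCat.ofHom R.val.toRingHom) := by
    rw [← Spec.map_comp, ← CommRingCat.ofHom_comp, hι]
  -- ### Step 2: the model `X₁ = X' ×_R Spec K₁` over `K₁` and `X ≅ X₁ ×_{K₁} Spec L`
  let f₁ : pullback p' (Spec.map (CommRingCat.ofHom ι)) ⟶ Spec (.of K₁) := pullback.snd _ _
  have hw : π ≫ p' = (f ≫ Spec.map (CommRingCat.ofHom (algebraMap K₁ L))) ≫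
      Spec.map (CommRingCat.ofHom ι) := by
    rw [Category.assoc, hfac]; exact hsq.w
  let c : X ⟶ pullback p' (Spec.map (CommRingCat.ofHom ι)) :=
    pullback.lift π (f ≫ Spec.map (CommRingCat.ofHom (algebraMap K₁ L))) hw
  have hc₁ : c ≫ pullback.fst _ _ = π := pullback.lift_fst _ _ _
  have hc₂ : c ≫ f₁ = f ≫ Spec.map (CommRingCat.ofHom (algebraMap K₁ L)) := pullback.lift_snd _ _ _
  have hbig : IsPullback (c ≫ pullback.fst _ _) f p'
      (Spec.map (CommRingCat.ofHom (algebraMap K₁ L)) ≫ Spec.map (CommRingCat.ofHom ι)) := by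
    rw [hc₁, hfac]; exact hsq
  have T : IsPullback c f f₁ (Spec.map (CommRingCat.ofHom (algebraMap K₁ L))) :=
    hbig.of_right hc₂ (IsPullback.of_hasPullback p' (Spec.map (CommRingCat.ofHom ι)))
  -- `X → X₁` is flat and surjective, so `X₁` is integral; and `X₁ ×_{K₁} Spec L ≅ X` is integral
  haveI : Flat c := MorphismProperty.of_isPullback (P := @Flat) T.flip
    (DeJong1996.Stage.flat_specMap (algebraMap K₁ L))
  haveI : Surjective c := MorphismProperty.of_isPullback (P := @Surjective) T.flip
    (DeJong1996.Stage.surjective_specMap (algebraMap K₁ L))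
  haveI : IsIntegral (pullback p' (Spec.map (CommRingCat.ofHom ι))) :=
    DeJong1996.Stage.isIntegral_of_flat_surjective c
  have hint : IsIntegral
      (pullback f₁ (Spec.map (CommRingCat.ofHom (algebraMap K₁ L)))) := by
    haveI : Nonempty ↥(pullback f₁ (Spec.map (CommRingCat.ofHom (algebraMap K₁ L)))) :=
      ⟨T.isoPullback.hom.base (Nonempty.some inferInstance)⟩
    exact isIntegral_of_isOpenImmersion T.isoPullback.inv
  -- ### Step 3: the smooth twist over a finite purely inseparable `K' / K₁`, and `K' ↪ L`
  obtain ⟨K', _, _, _, _, Y, ρ, hprop, hbir, hsm⟩ := h K₁ hFG₁ _ f₁ inferInstance inferInstance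
    inferInstance ⟨L, inferInstance, inferInstance, inferInstance, inferInstance, hint⟩
  haveI := hprop
  haveI := hsm
  haveI : CharP K' p := charP_of_injective_algebraMap (algebraMap K₁ K').injective p
  haveI : ExpChar K' p := ExpChar.prime hp
  haveI : PerfectRing L p := PerfectField.toPerfectRing p
  let j : K' →+* L := PerfectRing.lift (algebraMap K₁ K') (algebraMap K₁ L) p
  have hj : j.comp (algebraMap K₁ K') = algebraMap K₁ L := PerfectRing.lift_comp _ _ p
  have e' : Spec.map (CommRingCat.ofHom j) ≫ Spec.map (CommRingCat.ofHom (algebraMap K₁ K')) =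
      Spec.map (CommRingCat.ofHom (algebraMap K₁ L)) := by
    rw [← Spec.map_comp, ← CommRingCat.ofHom_comp, hj]
  -- ### Step 4: base change of the smooth model along the flat `Spec L → Spec K'`
  haveI : Flat (Spec.map (CommRingCat.ofHom j)) := DeJong1996.Stage.flat_specMap j
  haveI : IsNoetherian (pullback f₁ (Spec.map (CommRingCat.ofHom (algebraMap K₁ K')))) :=
    Scheme.isNoetherian_of_finiteType_over_field
      (pullback.snd f₁ (Spec.map (CommRingCat.ofHom (algebraMap K₁ K'))))
  haveI : IsNoetherian Y :=
    Scheme.isNoetherian_of_finiteType_over_field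
      (ρ ≫ pullback.snd f₁ (Spec.map (CommRingCat.ofHom (algebraMap K₁ K'))))
  -- the source `Y ×_{K'} Spec L` is smooth over the field `L`, hence regular (Stacks 056S)
  have hreg : Scheme.IsRegular (pullback
      (ρ ≫ pullback.snd f₁ (Spec.map (CommRingCat.ofHom (algebraMap K₁ K'))))
      (Spec.map (CommRingCat.ofHom j))) := fun y =>
    isRegularLocalRing_stalk_of_smooth_of_field
      (pullback.snd (ρ ≫ pullback.snd f₁ (Spec.map (CommRingCat.ofHom (algebraMap K₁ K'))))
        (Spec.map (CommRingCat.ofHom j))) y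
  have hres := hasResolution_pullback_snd_of_flat f₁
    (Spec.map (CommRingCat.ofHom (algebraMap K₁ K'))) (Spec.map (CommRingCat.ofHom j)) ρ hbir hreg
  -- transport along `(X₁ ×_{K₁} K') ×_{K'} L ≅ X₁ ×_{K₁} L ≅ X`
  exact (hres.of_iso
    (pullbackLeftPullbackSndIso f₁ (Spec.map (CommRingCat.ofHom (algebraMap K₁ K')))
        (Spec.map (CommRingCat.ofHom j)) ≪≫ pullback.congrHom rfl e').hom).of_iso
    T.isoPullback.inv

end Summit.ResolutionOfSingularities.ResolutionOfSingularities.Theorems.PrimeFieldToPerfect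

end
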